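import Summits.ResolutionOfSingularities.ResolutionOfSingularities.Theorems.WeightedInvariantLocalWeightedDropNCArrangements

/-!
# `LocalWeightedDrop`, line `nc-game-transport`, rung R2: a CONCRETE WITNESS in four variables — `x₀ · x₁ · (x₀ + x₁) · x₂`

[OURS · L1 W4.3 · chain w43, engine crux `LocalWeightedDrop` stmt-ResolutionOfSingularities-8899; strategist res-L1-w43-strat-1's line
`nc-game-transport`, TOT rung R2 (res-type-088, `…NCArrangements` p514936).]  The smallest arrangement in four variables that is not a
normal crossing and not a cylinder over a normal crossing: the germ `x₀ x₁ (x₀ + x₁) x₂` (order `4`; WILD in characteristic `2`, so an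
instance of the open residual W4|₄ `stub_wildWideApexFourStartsWon`'s regime) is WON in the local weighted resolution game over every field
of every prime characteristic — the rung `NCArrangement.won_of_dvd_arrangement_pow` instantiated (the centre of the winning first move is
the line `x₀ = x₁ = 0`, the flat of the core `{x₀, x₁, x₀+x₁}`; the origin would stall).  A kernel-checked BC5-style witness for the census
of the residual; nothing here is a statement of any manuscript.
-/

set_option linter.dupNamespace false -- mandated namespace of this single-conjunct summit

namespace Summit.ResolutionOfSingularities.ResolutionOfSingularities.Theorems

namespace NCArrangement

open MvPowerSeries Literature.AlgebraicGeometry.Resolution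

/-- The coefficient vectors of the four forms `x₀, x₁, x₀ + x₁, x₂`. -/
theorem fourForms_ne_zero (k : Type) [Field k] : ∀ j ∈ (Finset.univ : Finset (Fin 4)),
    (![Pi.single 0 1, Pi.single 1 1, (Pi.single (0 : Fin 4) (1 : k) : Fin 4 → k) + Pi.single (1 : Fin 4) (1 : k), Pi.single 2 1] :
      Fin 4 → Fin 4 → k) j ≠ 0 := by
  intro j _
  fin_cases j
  · simp
  · simp
  · intro h
    have := congr_fun h 0
    simp at this
  · simp

/-- The germ `x₀ x₁ (x₀ + x₁) x₂` is the product of the four forms. -/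
theorem fourVarArrangement_eq (k : Type) [Field k] :
    (X 0 : MvPowerSeries (Fin 4) k) * X 1 * (X 0 + X 1) * X 2 =
      1 * ∏ j ∈ (Finset.univ : Finset (Fin 4)),
        linForm ((![Pi.single 0 1, Pi.single 1 1, (Pi.single (0 : Fin 4) (1 : k) : Fin 4 → k) + Pi.single (1 : Fin 4) (1 : k),
          Pi.single 2 1] : Fin 4 → Fin 4 → k) j) := by
  rw [one_mul, Fin.prod_univ_four]
  simp only [Matrix.cons_val_zero, Matrix.cons_val_one, Matrix.cons_val]
  rw [linForm_single, linForm_single, linForm_single]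
  have : linForm ((Pi.single (0 : Fin 4) (1 : k) : Fin 4 → k) + Pi.single (1 : Fin 4) (1 : k)) = X 0 + X 1 := by
    unfold linForm
    simp [Fin.sum_univ_four, Pi.single_apply]
  rw [this]

/-- **WITNESS (OURS · L1 W4.3, rung R2): `x₀ · x₁ · (x₀ + x₁) · x₂` IS WON in the local weighted resolution game `CobordantGame.Won k 4`
over every field of every prime characteristic** — in particular in characteristic `2`, where the germ is wild (`2 ∣ ord = 4`). -/
theorem won_fourVarArrangement (k : Type) [Field k] (p : ℕ) (hp : p.Prime) [CharP k p] :
    CobordantGame.Won k 4 ((X 0 : MvPowerSeries (Fin 4) k) * X 1 * (X 0 + X 1) * X 2) := by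
  rw [fourVarArrangement_eq]
  exact won_of_dvd_arrangement_pow p hp 1 (by rw [map_one]; exact one_ne_zero) Finset.univ _ (fourForms_ne_zero k) 0 _
    (by rw [zero_add, pow_one])

/-- … and so is every divisor of any of its powers, e.g. `x₀^a x₁^b (x₀ + x₁)^c x₂^e`. -/
theorem won_of_dvd_fourVarArrangement_pow (k : Type) [Field k] (p : ℕ) (hp : p.Prime) [CharP k p] (N : ℕ)
    (f : MvPowerSeries (Fin 4) k) (hf : f ∣ ((X 0 : MvPowerSeries (Fin 4) k) * X 1 * (X 0 + X 1) * X 2) ^ (N + 1)) :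
    CobordantGame.Won k 4 f := by
  rw [fourVarArrangement_eq] at hf
  exact won_of_dvd_arrangement_pow p hp 1 (by rw [map_one]; exact one_ne_zero) Finset.univ _ (fourForms_ne_zero k) N f hf

end NCArrangement

end Summit.ResolutionOfSingularities.ResolutionOfSingularities.Theorems
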